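import Literature.NumberTheory.Sieve.PolymathLcmSumsKernel
import HarnessLib

/-!
# Polymath 8b, Lemma 4.1 PROVED (`moebiusLcmSums_asymptotic_holds`) and Theorem 3.6(i) PROVED (`divisorSumWeights_asymptotic_holds`)

Trunk: AntSieve / parity.S13.  Companion ("Proofs") file closing the fifth layer of the
decomposition of the named fact `Literature.NumberTheory.Sieve.frequently_nth_prime_succ_le_add_polymath`
(`H₁ ≤ 246`): the key asymptotic **Lemma 4.1** of D. H. J. Polymath, *Variants of the Selberg sieve,
and bounded intervals containing many primes*, Res. Math. Sci. 1:12 (2014) = arXiv:1407.4897, p. 12,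
in the case `N = 1` and for a general denominator weight `w` (`IsLcmWeight`: `1/[d_j,d'_j]` as printed,
and the variant `1/φ([d_j,d'_j])` needed for Theorem 3.5(i)), and with it the named facts

* `Literature.NumberTheory.Sieve.moebiusLcmSums_asymptotic` (`PolymathLcmSums.lean`, Lemma 4.1 with
  denominators `[d_j,d'_j]`): `moebiusLcmSums_asymptotic_holds`;
* `Literature.NumberTheory.Sieve.divisorSumWeights_asymptotic` (`PolymathSieveAsymptotics.lean`,
  **Theorem 3.6(i)**): `divisorSumWeights_asymptotic_holds`, through the already proved §4.1 reduction
  `divisorSumWeights_asymptotic_of_lcmSums`.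

The argument is the printed one (pp. 12–13), made quantitative, on top of
`PolymathLcmSumsKernel.lean` ((multisum) `= ∫ Φ K_x`, (fg-int)), `PolymathLcmSumsEuler.lean` /
`PolymathLcmSumsZeta.lean` (`K = E · Z`, (kp-est), crude bounds, the pole) and
`PolymathLcmSumsFourier.lean` (`∫∫ (1+iξ)(1+iξ')/(2+iξ+iξ') f g = ∫_0^∞ F'G'`):

* `LcmEuler.zetaN x s = ζ_W(1 + s/log x) s/B` and `eventually_norm_zetaN_sub_one_le`: **the simple
  pole**, "`ζ_{W}(1 + (1+iξ)/log x) = (1+o(1)) B/(1+iξ)`" uniformly for `Re s ≥ 1`, `|s| ≤ c√log x`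
  (from `riemannZeta_residue_one` via `exists_delta_zeta_pole`, and `∏_{p∣W}(1-p^{-1-u}) = (1+o(1))φ(W)/W`
  via `exists_prod_primeFactors_eq`, using `W ≤ log² x`, `ω(W) ≤ ⌊w⌋ + 1 ≤ log log x + 1`).
* `LcmEuler.pairModel p = M(ξ,ξ') = ∏_j (1+iξ_j)(1+iξ'_j)/(2+iξ_j+iξ'_j)`, `pow_mul_zetaLimit_eq`
  (`B^k Z = M · ∏_j N(s_j+s'_j)/(N(s_j)N(s'_j))`, exact algebra) and **(kt)**
  `eventually_norm_sub_pairModel_le`: `‖B^k K_x − M‖ ≤ ε‖M‖` on the cube `|ξ_j|,|ξ'_j| ≤ √log x`.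
* `eventually_norm_pow_mul_freqKernel_le`: "`K = O(log^{3k} x)`", as `‖B^k K_x‖ ≤ e^{C(k)}4^k log^{4k} x`.
* Majorants `psiMaj`, `PsiMaj = Ψ`, `PsiMajB = Ψ_n` built from the rapidly decreasing weights
  (integrable), `integral_fourierPhi_mul_pairModel` (`∫ Φ M = c = ∏_j ∫_0^∞ F_j'G_j'`), and the
  pointwise bound `eventually_pointwise_bound`:
  `‖Φ(B^k K_x − M)‖ ≤ εΨ + (C₀+1)(1+√log x)^{-1} Ψ_{8k+1}` (the tails outside the cube are absorbed by
  `log^{4k} x ≤ |ξ_i|^{8k}` for the offending coordinate — "the contribution … outside of the cube … is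
  negligible").
* `tendsto_pow_mul_lcmSumW`: **Lemma 4.1 for a general weight**, `B^k · (multisum) → c`; the real,
  `o(B^{-k})` form for `w = 1/n` is `moebiusLcmSums_asymptotic_holds`.

## References

* D. H. J. Polymath, *Variants of the Selberg sieve, and bounded intervals containing many primes*,
  Res. Math. Sci. 1 (2014), Art. 12; arXiv:1407.4897, Lemma 4.1 and its proof (pp. 12–13), §4.1.
  [Polymath8b2014]
-/

noncomputable section

open MeasureTheory Filter Finset Asymptotics Real
open scoped BigOperators Topology ArithmeticFunction.Moebius

namespace Literature.NumberTheory.Sieve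

variable {ι : Type*} [Fintype ι] [DecidableEq ι]

namespace LcmEuler

/-! ## Main term analysis: the pole of `ζ` and the cube `|ξ| ≤ √log x` -/

section MainTerm

/-! ### Elementary eventual behaviour of `log x`, `W`, `w` -/

omit [Fintype ι] [DecidableEq ι] in
/-- `log L / √L → 0`. [folklore] -/
theorem tendsto_log_div_sqrt : Tendsto (fun L : ℝ => Real.log L / Real.sqrt L) atTop (𝓝 0) := by
  have h := (isLittleO_log_rpow_atTop (r := 1 / 2) (by norm_num)).tendsto_div_nhds_zero
  refine h.congr' ?_
  filter_upwards [eventually_ge_atTop (0 : ℝ)] with L hL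
  rw [Real.sqrt_eq_rpow]

omit [Fintype ι] [DecidableEq ι] in
/-- `log log x / √log x → 0`. [folklore] -/
theorem tendsto_loglog_div_sqrt_log :
    Tendsto (fun x : ℝ => Real.log (Real.log x) / Real.sqrt (Real.log x)) atTop (𝓝 0) :=
  tendsto_log_div_sqrt.comp Real.tendsto_log_atTop

omit [Fintype ι] [DecidableEq ι] in
/-- `1/√log x → 0`. [folklore] -/
theorem tendsto_inv_sqrt_log : Tendsto (fun x : ℝ => (Real.sqrt (Real.log x))⁻¹) atTop (𝓝 0) :=
  tendsto_inv_atTop_zero.comp (Real.tendsto_sqrt_atTop.comp Real.tendsto_log_atTop)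

omit [Fintype ι] [DecidableEq ι] in
/-- `⌊w⌋ ≤ log log x` eventually (`w = log log log x ≤ log log x - 1`). [folklore] -/
theorem eventually_floor_polymathw_le :
    ∀ᶠ x : ℝ in atTop, (⌊polymathw x⌋₊ : ℝ) ≤ Real.log (Real.log x) := by
  filter_upwards [(Real.tendsto_log_atTop.comp Real.tendsto_log_atTop).eventually_ge_atTop 1] with x hx
  have hll : 1 ≤ Real.log (Real.log x) := hx
  rcases lt_or_ge (polymathw x) 0 with hw | hw
  · rw [Nat.floor_of_nonpos hw.le, Nat.cast_zero]; linarith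
  · calc (⌊polymathw x⌋₊ : ℝ) ≤ polymathw x := Nat.floor_le hw
      _ ≤ Real.log (Real.log x) - 1 := Real.log_le_sub_one_of_pos (by linarith)
      _ ≤ _ := by linarith

omit [Fintype ι] [DecidableEq ι] in
/-- The number of prime factors of `W` is at most `⌊w⌋ + 1`. [folklore] -/
theorem card_primeFactors_polymathW_le (x : ℝ) :
    ((polymathW x).primeFactors.card : ℝ) ≤ ⌊polymathw x⌋₊ + 1 := by
  have h : (polymathW x).primeFactors.card ≤ ⌊polymathw x⌋₊ + 1 := by
    rw [polymathW, primeFactors_primorial, Nat.primesLE, Nat.primesBelow]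
    exact (Finset.card_filter_le _ _).trans (by simp)
  exact_mod_cast h

omit [Fintype ι] [DecidableEq ι] in
/-- Primes not dividing `W` exceed `⌊w⌋`. [folklore] -/
theorem floor_polymathw_lt_of_not_dvd {x : ℝ} {q : ℕ} (hq : q.Prime) (hqW : ¬ q ∣ polymathW x) :
    ⌊polymathw x⌋₊ + 1 ≤ q := by
  by_contra h
  apply hqW
  have hmem : q ∈ (polymathW x).primeFactors := by
    rw [polymathW, primeFactors_primorial, Nat.mem_primesLE]
    exact ⟨by omega, hq⟩
  exact Nat.dvd_of_mem_primeFactors hmem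

/-! ### The normalised zeta values `N_x(s) := ζ_W(1 + s/log x) · s / B` -/

/-- `N_x(s) := ζ_W(1 + s/log x) s / B`, the modified zeta value normalised by its asymptotic
`B/(1+iξ)` ("`ζ_{WN}(1 + (1+iξ_j)/log x) = (1+o(1)) B φ(N)/((1+iξ_j)N)`", Polymath 8b p. 12, here `N = 1`).
[cite: Polymath8b2014, Lemma 4.1 (proof, p. 12)] -/
def zetaN (x : ℝ) (s : ℂ) : ℂ :=
  zetaW (polymathW x) (1 + s / (Real.log x : ℂ)) * s / (polymathB x : ℂ)

omit [Fintype ι] [DecidableEq ι] in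
/-- `ζ_W(1 + s/L) = N_x(s) B / s`. [folklore] -/
theorem zetaW_eq_zetaN {x : ℝ} (hx : 1 < x) {s : ℂ} (hs : s ≠ 0) :
    zetaW (polymathW x) (1 + s / (Real.log x : ℂ)) = zetaN x s * (polymathB x : ℂ) / s := by
  have hB : (polymathB x : ℂ) ≠ 0 := by exact_mod_cast (polymathB_pos hx).ne'
  rw [zetaN]; field_simp

omit [Fintype ι] [DecidableEq ι] in
/-- The identity `N_x(s) = (u ζ(1+u)) · ρ` with `u = s/log x` and
`∏_{p ∣ W}(1 - p^{-1-u}) = (φ(W)/W) ρ`. [folklore] -/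
theorem zetaN_eq {x : ℝ} (hx : 1 < x) (s : ℂ) {ρ : ℂ}
    (hρ : ∏ p ∈ (polymathW x).primeFactors, (1 - (p : ℂ) ^ (-(1 + s / (Real.log x : ℂ)))) =
      ((Nat.totient (polymathW x) : ℝ) / (polymathW x) : ℝ) * ρ) :
    zetaN x s = (s / (Real.log x : ℂ) * riemannZeta (1 + s / (Real.log x : ℂ))) * ρ := by
  have hL : (Real.log x : ℂ) ≠ 0 := by exact_mod_cast (Real.log_pos hx).ne'
  have hφ : (((Nat.totient (polymathW x) : ℝ) / (polymathW x) : ℝ) : ℂ) ≠ 0 := by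
    have h1 : (0 : ℝ) < Nat.totient (polymathW x) := Nat.cast_pos.2 (totient_polymathW_pos x)
    have h2 : (0 : ℝ) < polymathW x := Nat.cast_pos.2 (polymathW_pos x)
    exact_mod_cast (div_pos h1 h2).ne'
  have hB : (polymathB x : ℂ) = (((Nat.totient (polymathW x) : ℝ) / (polymathW x) : ℝ) : ℂ) *
      (Real.log x : ℂ) := by
    rw [polymathB]; push_cast; ring
  rw [zetaN, zetaW, hρ, hB]
  field_simp

omit [Fintype ι] [DecidableEq ι] in
/-- **The simple pole, uniformly on `|s| ≤ c √log x`**: for every `ε > 0` and `c`, eventually in `x`,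
`‖N_x(s) - 1‖ ≤ ε` for all `s` with `Re s ≥ 1` and `‖s‖ ≤ c √log x` (Polymath 8b p. 12: "When
`|ξ_j| ≤ √log x`, we see from the simple pole of the Riemann zeta function at `s = 1` that
`ζ(1 + (1+iξ_j)/log x) = (1+o(1)) log x/(1+iξ_j)` … Since `log(WN) ≪ log^{O(1)} x`, this gives
`∏_{p ∣ WN}(1 - p^{-1-(1+iξ_j)/log x}) = (1+o(1)) φ(WN)/(WN)` … Thus
`ζ_{WN}(1 + (1+iξ_j)/log x) = (1+o(1)) B φ(N)/((1+iξ_j) N)`. Similarly with `1+iξ_j` replaced by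
`1+iξ'_j` or `2+iξ_j+iξ'_j`"). [cite: Polymath8b2014, Lemma 4.1 (proof, p. 12)] -/
theorem eventually_norm_zetaN_sub_one_le {ε : ℝ} (hε : 0 < ε) (c : ℝ) :
    ∀ᶠ x : ℝ in atTop, ∀ s : ℂ, 1 ≤ s.re → ‖s‖ ≤ c * Real.sqrt (Real.log x) →
      ‖zetaN x s - 1‖ ≤ ε := by
  -- constants
  set ε₁ : ℝ := min ε 1 / 3 with hε₁
  have hε₁pos : 0 < ε₁ := by positivity
  have hε₁le : ε₁ ≤ 1 / 3 := by rw [hε₁]; linarith [min_le_right ε 1]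
  have h3ε₁ : 3 * ε₁ ≤ ε := by rw [hε₁]; linarith [min_le_left ε 1]
  obtain ⟨δ, hδ, hpole⟩ := exists_delta_zeta_pole hε₁pos
  set c' : ℝ := |c| + 1 with hc'
  have hc'pos : 0 < c' := by positivity
  -- the small parameter `τ = c'/√log x` and the eventual conditions
  have hτ : Tendsto (fun x : ℝ => c' * (Real.sqrt (Real.log x))⁻¹) atTop (𝓝 0) := by
    simpa using tendsto_inv_sqrt_log.const_mul c'
  have hτlog : Tendsto (fun x : ℝ => c' * (Real.sqrt (Real.log x))⁻¹ *
      (2 * Real.log (Real.log x) + 2)) atTop (𝓝 0) := by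
    have h1 : Tendsto (fun x : ℝ => 2 * c' * (Real.log (Real.log x) / Real.sqrt (Real.log x)) +
        2 * (c' * (Real.sqrt (Real.log x))⁻¹)) atTop (𝓝 0) := by
      simpa using (tendsto_loglog_div_sqrt_log.const_mul (2 * c')).add (hτ.const_mul 2)
    refine h1.congr' (Eventually.of_forall fun x => ?_)
    simp only [div_eq_mul_inv]; ring
  have hexp : Tendsto (fun x : ℝ => Real.exp (c' * (Real.sqrt (Real.log x))⁻¹ *
      (2 * Real.log (Real.log x) + 2))) atTop (𝓝 1) := by
    have h := (Real.continuous_exp.tendsto 0).comp hτlog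
    rw [Real.exp_zero] at h
    exact h
  filter_upwards [eventually_gt_atTop (1 : ℝ),
    (Real.tendsto_log_atTop.comp Real.tendsto_log_atTop).eventually_ge_atTop 1,
    hτ.eventually_lt_const hδ, hτlog.eventually_le_const (show (0 : ℝ) < 1 by norm_num),
    hexp.eventually_le_const (show (1 : ℝ) < 1 + ε₁ by linarith),
    eventually_polymathW_le_log_sq, eventually_floor_polymathw_le] with x hx hll hτδ hτ1 hexp1 hWle hwle
  intro s hsre hsn
  have hll' : 1 ≤ Real.log (Real.log x) := hll
  have hL : 0 < Real.log x := Real.log_pos hx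
  have hsqrt : 0 < Real.sqrt (Real.log x) := Real.sqrt_pos.2 hL
  have hs0 : s ≠ 0 := fun h => by rw [h, Complex.zero_re] at hsre; linarith
  have hLc : (Real.log x : ℂ) ≠ 0 := by exact_mod_cast hL.ne'
  -- `u = s / log x` is small
  have hu0 : s / (Real.log x : ℂ) ≠ 0 := div_ne_zero hs0 hLc
  have hun : ‖s / (Real.log x : ℂ)‖ ≤ c' * (Real.sqrt (Real.log x))⁻¹ := by
    rw [norm_div, Complex.norm_real, Real.norm_eq_abs, abs_of_pos hL, div_le_iff₀ hL]
    have h1 : ‖s‖ ≤ c' * Real.sqrt (Real.log x) := by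
      refine hsn.trans (mul_le_mul_of_nonneg_right ?_ hsqrt.le)
      rw [hc']; linarith [le_abs_self c]
    have h2 : c' * Real.sqrt (Real.log x) = c' * (Real.sqrt (Real.log x))⁻¹ * Real.log x := by
      have hs := Real.mul_self_sqrt hL.le
      field_simp
      linarith [hs]
    linarith [h1, h2]
  -- (a) the pole
  have hA : ‖s / (Real.log x : ℂ) * riemannZeta (1 + s / (Real.log x : ℂ)) - 1‖ ≤ ε₁ :=
    hpole _ hu0 (lt_of_le_of_lt hun hτδ)
  -- (b) the primes dividing `W`
  have hlogp : ∀ p ∈ (polymathW x).primeFactors, ‖s / (Real.log x : ℂ)‖ * Real.log p ≤ 1 := by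
    intro p hp
    have hpp := Nat.prime_of_mem_primeFactors hp
    have hpW : (p : ℝ) ≤ polymathW x := by exact_mod_cast Nat.le_of_mem_primeFactors hp
    have hp0 : (0 : ℝ) < p := by exact_mod_cast hpp.pos
    have hlog1 : Real.log p ≤ 2 * Real.log (Real.log x) := by
      calc Real.log p ≤ Real.log (Real.log x ^ 2) := Real.log_le_log hp0 (hpW.trans hWle)
        _ = 2 * Real.log (Real.log x) := by rw [Real.log_pow]; push_cast; ring
    have hlog0 : 0 ≤ Real.log p := Real.log_natCast_nonneg p
    calc ‖s / (Real.log x : ℂ)‖ * Real.log p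
        ≤ (c' * (Real.sqrt (Real.log x))⁻¹) * (2 * Real.log (Real.log x) + 2) := by
          refine mul_le_mul hun (by linarith) hlog0 (by positivity)
      _ ≤ 1 := hτ1
  obtain ⟨ρ, hρ, hρ1⟩ := exists_prod_primeFactors_eq (polymathW_pos x).ne' hlogp
  have hB : ‖ρ - 1‖ ≤ ε₁ := by
    refine hρ1.trans ?_
    have hcard := card_primeFactors_polymathW_le x
    have hle : 2 * ‖s / (Real.log x : ℂ)‖ * ((polymathW x).primeFactors.card : ℝ) ≤
        c' * (Real.sqrt (Real.log x))⁻¹ * (2 * Real.log (Real.log x) + 2) := by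
      have h0 : 0 ≤ ‖s / (Real.log x : ℂ)‖ := norm_nonneg _
      calc 2 * ‖s / (Real.log x : ℂ)‖ * ((polymathW x).primeFactors.card : ℝ)
          ≤ 2 * (c' * (Real.sqrt (Real.log x))⁻¹) * (Real.log (Real.log x) + 1) := by
            refine mul_le_mul (by linarith) (hcard.trans (by linarith)) (by positivity) (by positivity)
        _ = _ := by ring
    linarith [Real.exp_le_exp.2 hle]
  -- (c) combine
  rw [zetaN_eq hx s hρ]
  have hρn : ‖ρ‖ ≤ 1 + ε₁ := by
    have := norm_le_norm_add_norm_sub' ρ 1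
    rw [norm_one] at this; linarith [norm_sub_rev ρ 1]
  have e : s / (Real.log x : ℂ) * riemannZeta (1 + s / (Real.log x : ℂ)) * ρ - 1 =
      (s / (Real.log x : ℂ) * riemannZeta (1 + s / (Real.log x : ℂ)) - 1) * ρ + (ρ - 1) := by ring
  rw [e]
  refine (norm_add_le _ _).trans ?_
  rw [norm_mul]
  have h0 : 0 ≤ ‖s / (Real.log x : ℂ) * riemannZeta (1 + s / (Real.log x : ℂ)) - 1‖ := norm_nonneg _
  nlinarith [mul_le_mul hA hρn (norm_nonneg _) hε₁pos.le]

/-! ### The model `M(ξ,ξ') = ∏_j (1+iξ_j)(1+iξ'_j)/(2+iξ_j+iξ'_j)` and the cube `|ξ| ≤ √log x` -/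

/-- `M(ξ, ξ') := ∏_j (1+iξ_j)(1+iξ'_j)/(2+iξ_j+iξ'_j)` (in Mathlib's normalisation), the limit of
`B^k K` in (kt), Polymath 8b p. 13. [cite: Polymath8b2014, Lemma 4.1 (proof, (kt))] -/
def pairModel (p : ι → ℝ × ℝ) : ℂ := ∏ j, lcmPairKernel (p j)

/-- The cube `{max(|ξ_1|,…,|ξ_k|,|ξ'_1|,…,|ξ'_k|) ≤ R}` (used with `R = √log x`, Polymath 8b p. 12).
[cite: Polymath8b2014, Lemma 4.1 (proof, p. 12)] -/
def InCube (R : ℝ) (p : ι → ℝ × ℝ) : Prop := ∀ j, |(p j).1| ≤ R ∧ |(p j).2| ≤ R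

omit [Fintype ι] [DecidableEq ι] in
/-- `‖u₃/(u₁u₂) - 1‖ ≤ 8δ` when `‖uᵢ - 1‖ ≤ δ ≤ 1/4`. [folklore] -/
theorem norm_div_mul_sub_one_le {u₁ u₂ u₃ : ℂ} {δ : ℝ} (hδ : δ ≤ 1 / 4) (h₁ : ‖u₁ - 1‖ ≤ δ)
    (h₂ : ‖u₂ - 1‖ ≤ δ) (h₃ : ‖u₃ - 1‖ ≤ δ) : ‖u₃ / (u₁ * u₂) - 1‖ ≤ 8 * δ := by
  have hδ0 : 0 ≤ δ := (norm_nonneg _).trans h₁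
  have hn1 : 3 / 4 ≤ ‖u₁‖ := by
    have := norm_le_norm_add_norm_sub' (1 : ℂ) u₁
    rw [norm_one, norm_sub_rev] at this; linarith
  have hn2 : 3 / 4 ≤ ‖u₂‖ := by
    have := norm_le_norm_add_norm_sub' (1 : ℂ) u₂
    rw [norm_one, norm_sub_rev] at this; linarith
  have hprod : 1 / 2 ≤ ‖u₁ * u₂‖ := by rw [norm_mul]; nlinarith
  have hne : u₁ * u₂ ≠ 0 := fun h => by rw [h, norm_zero] at hprod; linarith
  have e : u₃ / (u₁ * u₂) - 1 = (u₃ - 1 - ((u₁ - 1) * (u₂ - 1) + (u₁ - 1) + (u₂ - 1))) / (u₁ * u₂) := by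
    rw [div_sub_one hne]; ring
  rw [e, norm_div, div_le_iff₀ (by linarith)]
  have hnum : ‖u₃ - 1 - ((u₁ - 1) * (u₂ - 1) + (u₁ - 1) + (u₂ - 1))‖ ≤ 4 * δ := by
    refine (norm_sub_le _ _).trans ?_
    have h4 : ‖(u₁ - 1) * (u₂ - 1) + (u₁ - 1) + (u₂ - 1)‖ ≤ δ * δ + δ + δ := by
      refine (norm_add_le _ _).trans (add_le_add ((norm_add_le _ _).trans (add_le_add ?_ h₁)) h₂)
      rw [norm_mul]; exact mul_le_mul h₁ h₂ (norm_nonneg _) hδ0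
    nlinarith
  nlinarith

omit [Fintype ι] [DecidableEq ι] in
/-- `‖∏ uᵢ - 1‖ ≤ exp(∑ ‖uᵢ - 1‖) - 1`. [folklore] -/
theorem norm_prod_sub_one_le_exp {κ : Type*} (s : Finset κ) (u : κ → ℂ) :
    ‖∏ i ∈ s, u i - 1‖ ≤ Real.exp (∑ i ∈ s, ‖u i - 1‖) - 1 := by
  have h := Finset.norm_prod_one_add_sub_one_le s (fun i => u i - 1)
  simpa only [add_sub_cancel] using h

/-- The correction factors `R_j := N_x(s_j + s'_j)/(N_x(s_j) N_x(s'_j))`. [folklore] -/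
def zetaRatio (x : ℝ) (q : ℝ × ℝ) : ℂ :=
  zetaN x (sOf q.1 + sOf q.2) / (zetaN x (sOf q.1) * zetaN x (sOf q.2))

omit [DecidableEq ι] in
/-- **`B^k Z = M · ∏_j R_j`**: the `ζ`-side product `Z = ∏_j ζ_W(1+a_j+b_j)/(ζ_W(1+a_j)ζ_W(1+b_j))`
at `a_j = s(ξ_j)/log x`, `b_j = s(ξ'_j)/log x`, multiplied by `B^k`, is the model `M` times the
correction factors (exact algebra behind (kt), Polymath 8b p. 13). [cite: Polymath8b2014, Lemma 4.1 (proof, (kt))] -/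
theorem pow_mul_zetaLimit_eq {x : ℝ} (hx : 1 < x) (p : ι → ℝ × ℝ)
    (hN : ∀ j, zetaN x (sOf (p j).1) ≠ 0 ∧ zetaN x (sOf (p j).2) ≠ 0) :
    (polymathB x : ℂ) ^ Fintype.card ι * zetaLimit (polymathW x) (expA x p) (expB x p) =
      pairModel p * ∏ j, zetaRatio x (p j) := by
  have hB : (polymathB x : ℂ) ≠ 0 := by exact_mod_cast (polymathB_pos hx).ne'
  rw [zetaLimit, pairModel, ← Finset.prod_mul_distrib, ← Finset.card_univ, ← Finset.prod_const,
    ← Finset.prod_mul_distrib]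
  refine Finset.prod_congr rfl fun j _ => ?_
  have hs1 := sOf_ne_zero (p j).1
  have hs2 := sOf_ne_zero (p j).2
  have hs12 : sOf (p j).1 + sOf (p j).2 ≠ 0 := fun h => by
    have := congrArg Complex.re h
    norm_num [sOf_re] at this
  have e3 : (1 : ℂ) + expA x p j + expB x p j = 1 + (sOf (p j).1 + sOf (p j).2) / (Real.log x : ℂ) := by
    simp only [expA, expB]; ring
  rw [e3, zetaW_eq_zetaN hx hs12, show (1 : ℂ) + expA x p j = 1 + sOf (p j).1 / (Real.log x : ℂ) from rfl,
    zetaW_eq_zetaN hx hs1, show (1 : ℂ) + expB x p j = 1 + sOf (p j).2 / (Real.log x : ℂ) from rfl,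
    zetaW_eq_zetaN hx hs2, lcmPairKernel_eq, zetaRatio]
  have h1 := (hN j).1
  have h2 := (hN j).2
  field_simp

omit [Fintype ι] [DecidableEq ι] in
/-- In the cube of side `R ≥ 1`, `‖s(ξ_j)‖, ‖s(ξ_j) + s(ξ'_j)‖ ≤ (2 + 4π) R`. [folklore] -/
theorem norm_sOf_le_of_inCube {R : ℝ} (hR : 1 ≤ R) {p : ι → ℝ × ℝ} (hp : InCube R p) (j : ι) :
    ‖sOf (p j).1‖ ≤ (2 + 4 * π) * R ∧ ‖sOf (p j).2‖ ≤ (2 + 4 * π) * R ∧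
      ‖sOf (p j).1 + sOf (p j).2‖ ≤ (2 + 4 * π) * R := by
  have hπ := Real.pi_pos
  have h1 := norm_sOf_le (p j).1
  have h2 := norm_sOf_le (p j).2
  have ha := (hp j).1
  have hb := (hp j).2
  have h1' : ‖sOf (p j).1‖ ≤ (2 + 4 * π) * R := by nlinarith
  have h2' : ‖sOf (p j).2‖ ≤ (2 + 4 * π) * R := by nlinarith
  refine ⟨h1', h2', (norm_add_le _ _).trans ?_⟩
  nlinarith

omit [Fintype ι] [DecidableEq ι] in
/-- `m = ⌊w⌋ + 1 → ∞`: eventually `m ≥ n` for every `n`. [folklore] -/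
theorem eventually_le_floor_polymathw (n : ℕ) : ∀ᶠ x : ℝ in atTop, n ≤ ⌊polymathw x⌋₊ + 1 := by
  filter_upwards [tendsto_polymathw_atTop.eventually_ge_atTop (n : ℝ)] with x hx
  have : n ≤ ⌊polymathw x⌋₊ := Nat.le_floor hx
  omega

/-- **(kt): `B^k K = (1 + o(1)) M` uniformly on the cube `|ξ_j|, |ξ'_j| ≤ √log x`** (Polymath 8b
p. 13: "We conclude that `K(ξ_1,…,ξ'_k) = (1+o(1)) B^{-k} (N^k/φ(N)^k) ∏_j (1+iξ_j)(1+iξ'_j)/(2+iξ_j+iξ'_j)`"),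
quantitatively: for every `ε > 0`, eventually in `x`, `‖B^k K_x(p) - M(p)‖ ≤ ε ‖M(p)‖` on the cube.
Ingredients: `K = E·Z` (`eulerKernel_eq_epsProd_mul_zetaLimit`), `‖E - 1‖ ≤ exp(2C(k)/m) - 1`
(`norm_epsProd_sub_one_le`, all primes `∤ W` exceed `⌊w⌋`), and the uniform pole estimate
`eventually_norm_zetaN_sub_one_le`. [cite: Polymath8b2014, Lemma 4.1 (proof, (kt))] -/
theorem eventually_norm_sub_pairModel_le {w : ℕ → ℂ} (hw : IsLcmWeight w) {ε : ℝ} (hε : 0 < ε) :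
    ∀ᶠ x : ℝ in atTop, ∀ p : ι → ℝ × ℝ, InCube (Real.sqrt (Real.log x)) p →
      ‖(polymathB x : ℂ) ^ Fintype.card ι * freqKernel w (polymathW x) x p - pairModel p‖ ≤
        ε * ‖pairModel p‖ := by
  set k : ℕ := Fintype.card ι with hk
  set mε : ℝ := min ε 1 with hmε
  have hmεpos : 0 < mε := by positivity
  have hmε1 : mε ≤ 1 := min_le_right _ _
  have hmεε : mε ≤ ε := min_le_left _ _
  set δ : ℝ := mε / (16 * k + 4) with hδ
  have hδpos : 0 < δ := by positivity
  have hδ4 : δ ≤ 1 / 4 := by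
    rw [hδ, div_le_iff₀ (by positivity)]; nlinarith [(Nat.cast_nonneg k : (0 : ℝ) ≤ k)]
  have hsum : (8 * k + 1) * δ ≤ mε / 2 := by
    rw [hδ]; field_simp; nlinarith [(Nat.cast_nonneg k : (0 : ℝ) ≤ k)]
  -- the size of `E - 1`
  set η : ℝ := min 1 (δ / 2) with hη
  have hηpos : 0 < η := by positivity
  have hC := epsConst_nonneg k
  filter_upwards [eventually_gt_atTop (1 : ℝ), Real.tendsto_log_atTop.eventually_ge_atTop 1,
    eventually_norm_zetaN_sub_one_le hδpos (2 + 4 * π), eventually_le_floor_polymathw 2,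
    eventually_le_floor_polymathw (7 * k),
    tendsto_polymathw_atTop.eventually_ge_atTop (2 * epsConst k / η)] with x hx hL1 hN hm2 hmk hwC
  intro p hp
  have hL : 0 < Real.log x := Real.log_pos hx
  have hR : 1 ≤ Real.sqrt (Real.log x) := Real.one_le_sqrt.2 hL1
  set m : ℕ := ⌊polymathw x⌋₊ + 1 with hm
  have hWm : ∀ q : ℕ, q.Prime → ¬ q ∣ polymathW x → m ≤ q :=
    fun q hq hqW => floor_polymathw_lt_of_not_dvd hq hqW
  have hab := expA_re_expB_re x p
  have hab0 : ∀ j, 0 ≤ (expA x p j).re ∧ 0 ≤ (expB x p j).re := fun j => by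
    rw [(hab j).1, (hab j).2]; exact ⟨by positivity, by positivity⟩
  -- `K = E Z`
  have hK : freqKernel w (polymathW x) x p =
      epsProd w (polymathW x) (expA x p) (expB x p) * zetaLimit (polymathW x) (expA x p) (expB x p) :=
    eulerKernel_eq_epsProd_mul_zetaLimit hw (polymathW_pos x).ne' (one_div_pos.2 hL) hab hm2 hmk hWm
  -- `‖E - 1‖ ≤ δ`
  have hE : ‖epsProd w (polymathW x) (expA x p) (expB x p) - 1‖ ≤ δ := by
    refine (norm_epsProd_sub_one_le hw hab0 hm2 hmk hWm).trans ?_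
    have hmw : polymathw x < (m : ℝ) := by rw [hm]; push_cast; exact Nat.lt_floor_add_one _
    have hmpos : (0 : ℝ) < m := by exact_mod_cast (show 0 < m by omega)
    have hy : 2 * epsConst k / m ≤ η := by
      rw [div_le_iff₀ hmpos]
      have h1 : 2 * epsConst k / η ≤ m := hwC.trans hmw.le
      rw [div_le_iff₀ hηpos] at h1
      linarith
    have hy0 : 0 ≤ 2 * epsConst k / m := by positivity
    have hy1 : |2 * epsConst k / m| ≤ 1 := by rw [abs_of_nonneg hy0]; exact hy.trans (min_le_left _ _)
    have h2 := Real.abs_exp_sub_one_le hy1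
    rw [abs_of_nonneg hy0] at h2
    have h3 : Real.exp (2 * epsConst k / m) - 1 ≤ 2 * (2 * epsConst k / m) := (le_abs_self _).trans h2
    calc Real.exp (2 * epsConst (Fintype.card ι) / m) - 1 ≤ 2 * (2 * epsConst k / m) := h3
      _ ≤ 2 * η := by linarith
      _ ≤ δ := by
          have := min_le_right 1 (δ / 2); rw [← hη] at this; linarith
  -- the `ζ`-values on the cube
  have hNle : ∀ j, ‖zetaN x (sOf (p j).1) - 1‖ ≤ δ ∧ ‖zetaN x (sOf (p j).2) - 1‖ ≤ δ ∧
      ‖zetaN x (sOf (p j).1 + sOf (p j).2) - 1‖ ≤ δ := by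
    intro j
    obtain ⟨h1, h2, h12⟩ := norm_sOf_le_of_inCube hR hp j
    refine ⟨hN _ (by simp) h1, hN _ (by simp) h2, hN _ ?_ h12⟩
    simp only [Complex.add_re, sOf_re]; norm_num
  have hNne : ∀ j, zetaN x (sOf (p j).1) ≠ 0 ∧ zetaN x (sOf (p j).2) ≠ 0 := by
    intro j
    constructor
    · intro h; have := (hNle j).1; rw [h, zero_sub, norm_neg, norm_one] at this; linarith
    · intro h; have := (hNle j).2.1; rw [h, zero_sub, norm_neg, norm_one] at this; linarith
  have hRj : ∀ j, ‖zetaRatio x (p j) - 1‖ ≤ 8 * δ := fun j =>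
    norm_div_mul_sub_one_le hδ4 (hNle j).1 (hNle j).2.1 (hNle j).2.2
  -- assemble: `B^k K - M = M (E ∏ R_j - 1)`
  rw [hK, mul_left_comm, pow_mul_zetaLimit_eq hx p hNne]
  set E := epsProd w (polymathW x) (expA x p) (expB x p) with hEdef
  have e' : E * (pairModel p * ∏ j, zetaRatio x (p j)) - pairModel p =
      pairModel p * (E * ∏ j, zetaRatio x (p j) - 1) := by ring
  rw [e', norm_mul, mul_comm]
  refine mul_le_mul_of_nonneg_right ?_ (norm_nonneg _)
  -- `‖E ∏ R_j - 1‖ ≤ exp(δ + 8kδ) - 1 ≤ ε`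
  have hprod : E * ∏ j, zetaRatio x (p j) = ∏ o : Option ι, Option.elim o E fun j => zetaRatio x (p j) := by
    rw [Fintype.prod_option]; rfl
  rw [hprod]
  refine (norm_prod_sub_one_le_exp _ _).trans ?_
  rw [Fintype.sum_option]
  simp only [Option.elim]
  have hs : ‖E - 1‖ + ∑ j, ‖zetaRatio x (p j) - 1‖ ≤ (8 * k + 1) * δ := by
    have h1 : ∑ j, ‖zetaRatio x (p j) - 1‖ ≤ ∑ _j : ι, 8 * δ := Finset.sum_le_sum fun j _ => hRj j
    rw [Finset.sum_const, Finset.card_univ, nsmul_eq_mul] at h1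
    rw [hk]; linarith
  have hy0 : 0 ≤ ‖E - 1‖ + ∑ j, ‖zetaRatio x (p j) - 1‖ := by positivity
  have hy1 : |‖E - 1‖ + ∑ j, ‖zetaRatio x (p j) - 1‖| ≤ 1 := by
    rw [abs_of_nonneg hy0]; linarith
  have h2 := Real.abs_exp_sub_one_le hy1
  rw [abs_of_nonneg hy0] at h2
  linarith [(le_abs_self _).trans h2]

/-! ### The crude bound `K = O(log^{3k} x)` in the form `‖B^k K_x‖ ≤ C₀ log^{4k} x` -/

/-- **`K = O(log^{3k} x)` everywhere** (Polymath 8b p. 12), with `B ≤ log x`: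
`‖B^k K_x(p)‖ ≤ e^{C(k)} 4^k log^{4k} x` for all large `x` and all frequencies `p`.
[cite: Polymath8b2014, Lemma 4.1 (proof, p. 12)] -/
theorem eventually_norm_pow_mul_freqKernel_le {w : ℕ → ℂ} (hw : IsLcmWeight w) :
    ∀ᶠ x : ℝ in atTop, ∀ p : ι → ℝ × ℝ,
      ‖(polymathB x : ℂ) ^ Fintype.card ι * freqKernel w (polymathW x) x p‖ ≤
        Real.exp (epsConst (Fintype.card ι)) * 4 ^ Fintype.card ι * Real.log x ^ (4 * Fintype.card ι) := by
  set k : ℕ := Fintype.card ι with hk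
  obtain ⟨δ₀, hδ₀, hζ⟩ := exists_delta_zetaR_le
  have hC := epsConst_nonneg k
  filter_upwards [eventually_gt_atTop (1 : ℝ), eventually_le_floor_polymathw 2,
    eventually_le_floor_polymathw (7 * k),
    (tendsto_inv_atTop_zero.comp Real.tendsto_log_atTop).eventually_lt_const (half_pos hδ₀)]
    with x hx hm2 hmk hσ
  intro p
  have hL : 0 < Real.log x := Real.log_pos hx
  have hσ' : (Real.log x)⁻¹ < δ₀ / 2 := hσ
  set m : ℕ := ⌊polymathw x⌋₊ + 1 with hm
  have hWm : ∀ q : ℕ, q.Prime → ¬ q ∣ polymathW x → m ≤ q :=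
    fun q hq hqW => floor_polymathw_lt_of_not_dvd hq hqW
  have hab := expA_re_expB_re x p
  have hKle := norm_eulerKernel_le_zeta hw (polymathW_pos x).ne' (one_div_pos.2 hL) hab hm2 hmk hWm
  have hz1 : zetaR (1 + 1 / Real.log x) ≤ 2 * Real.log x := by
    have h := hζ (1 / Real.log x) (by positivity) (by rw [one_div]; linarith)
    have e : (2 : ℝ) / (1 / Real.log x) = 2 * Real.log x := by field_simp
    rwa [e] at h
  have hz2 : zetaR (1 + 2 * (1 / Real.log x)) ≤ Real.log x := by
    have h := hζ (2 * (1 / Real.log x)) (by positivity) (by rw [one_div]; linarith)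
    have e : (2 : ℝ) / (2 * (1 / Real.log x)) = Real.log x := by field_simp
    rwa [e] at h
  have hz0 : 0 ≤ zetaR (1 + 1 / Real.log x) := zetaR_nonneg _
  have hz0' : 0 ≤ zetaR (1 + 2 * (1 / Real.log x)) := zetaR_nonneg _
  have hexp : Real.exp (2 * epsConst k / m) ≤ Real.exp (epsConst k) := by
    refine Real.exp_le_exp.2 ?_
    have hm2' : (2 : ℝ) ≤ m := by exact_mod_cast hm2
    rw [div_le_iff₀ (by linarith)]; nlinarith
  have hB0 : 0 < polymathB x := polymathB_pos hx
  have hBle : polymathB x ≤ Real.log x := polymathB_le_log hx.le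
  rw [norm_mul, norm_pow, Complex.norm_real, Real.norm_eq_abs, abs_of_pos hB0]
  have h3 : (zetaR (1 + 1 / Real.log x) ^ 2 * zetaR (1 + 2 * (1 / Real.log x))) ^ k ≤
      (4 * Real.log x ^ 3) ^ k := by
    refine pow_le_pow_left₀ (by positivity) ?_ k
    calc zetaR (1 + 1 / Real.log x) ^ 2 * zetaR (1 + 2 * (1 / Real.log x))
        ≤ (2 * Real.log x) ^ 2 * Real.log x :=
          mul_le_mul (pow_le_pow_left₀ hz0 hz1 2) hz2 hz0' (by positivity)
      _ = 4 * Real.log x ^ 3 := by ring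
  calc polymathB x ^ k * ‖freqKernel w (polymathW x) x p‖
      ≤ Real.log x ^ k * (Real.exp (epsConst k) * (4 * Real.log x ^ 3) ^ k) := by
        refine mul_le_mul (pow_le_pow_left₀ hB0.le hBle k) (hKle.trans ?_) (norm_nonneg _) (by positivity)
        exact mul_le_mul hexp h3 (by positivity) (by positivity)
    _ = Real.exp (epsConst k) * 4 ^ k * Real.log x ^ (4 * k) := by rw [mul_pow, pow_mul]; ring

end MainTerm

/-! ## Assembly: majorants, the pointwise bound, and the limit `B^k · (multisum) → c` -/

section Assembly

variable {F G : ι → ℝ → ℝ} {sF sG : ι → ℝ}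

/-! ### Majorants built from the rapidly decreasing weights -/

omit [Fintype ι] [DecidableEq ι] in
/-- The one-variable majorant `(1 + 2π|ξ|) |f(ξ)| (1 + |ξ|)^n` is integrable (rapid decay). [folklore] -/
theorem integrable_weightMaj {F₀ : ℝ → ℝ} {s : ℝ} (hF₀ : IsSieveCutoff F₀ s) (n : ℕ) :
    Integrable fun ξ : ℝ => (1 + 2 * π * |ξ|) * ‖hF₀.fourierWeight ξ‖ * (1 + |ξ|) ^ n := by
  have h := (hF₀.integrable_pow_mul_norm_fourierWeight (n + 1)).const_mul (2 * π)
  refine h.mono' ?_ (Eventually.of_forall fun ξ => ?_)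
  · exact (((by fun_prop : Continuous fun ξ : ℝ => 1 + 2 * π * |ξ|).mul
      hF₀.continuous_fourierWeight.norm).mul (by fun_prop)).aestronglyMeasurable
  · have hπ := Real.pi_gt_three
    have h0 : 0 ≤ ‖hF₀.fourierWeight ξ‖ := norm_nonneg _
    have h1 : 0 ≤ (1 + |ξ|) ^ n := by positivity
    have h2 : 1 + 2 * π * |ξ| ≤ 2 * π * (1 + |ξ|) := by nlinarith [abs_nonneg ξ]
    rw [Real.norm_of_nonneg (by positivity)]
    calc (1 + 2 * π * |ξ|) * ‖hF₀.fourierWeight ξ‖ * (1 + |ξ|) ^ n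
        ≤ (2 * π * (1 + |ξ|)) * ‖hF₀.fourierWeight ξ‖ * (1 + |ξ|) ^ n := by gcongr
      _ = 2 * π * ((1 + |ξ|) ^ (n + 1) * ‖hF₀.fourierWeight ξ‖) := by ring

/-- `ψ_j(ξ, ξ') := (1 + 2π|ξ|)|f_j(ξ)| · (1 + 2π|ξ'|)|g_j(ξ')|`, a majorant of
`|f_j(ξ) g_j(ξ') (1+iξ)(1+iξ')/(2+iξ+iξ')|`. [folklore] -/
def psiMaj (hF : ∀ j, IsSieveCutoff (F j) (sF j)) (hG : ∀ j, IsSieveCutoff (G j) (sG j))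
    (j : ι) (q : ℝ × ℝ) : ℝ :=
  ((1 + 2 * π * |q.1|) * ‖(hF j).fourierWeight q.1‖) * ((1 + 2 * π * |q.2|) * ‖(hG j).fourierWeight q.2‖)

/-- The boosted majorant `ψ_j(ξ,ξ') ((1+|ξ|)^n + (1+|ξ'|)^n)`. [folklore] -/
def psiMajB (hF : ∀ j, IsSieveCutoff (F j) (sF j)) (hG : ∀ j, IsSieveCutoff (G j) (sG j))
    (n : ℕ) (j : ι) (q : ℝ × ℝ) : ℝ :=
  psiMaj hF hG j q * ((1 + |q.1|) ^ n + (1 + |q.2|) ^ n)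

/-- `Ψ(p) := ∏_j ψ_j(p_j)`, a majorant of `|Φ(p)|` and of `|Φ(p) M(p)|`. [folklore] -/
def PsiMaj (hF : ∀ j, IsSieveCutoff (F j) (sF j)) (hG : ∀ j, IsSieveCutoff (G j) (sG j))
    (p : ι → ℝ × ℝ) : ℝ :=
  ∏ j, psiMaj hF hG j (p j)

/-- `Ψ_n(p) := ∑_i ∏_j (ψ_j or, for j = i, the boosted ψ_i)(p_j) = Ψ(p) ∑_i ((1+|ξ_i|)^n + (1+|ξ'_i|)^n)`,
the majorant used off the cube. [folklore] -/
def PsiMajB (hF : ∀ j, IsSieveCutoff (F j) (sF j)) (hG : ∀ j, IsSieveCutoff (G j) (sG j))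
    (n : ℕ) (p : ι → ℝ × ℝ) : ℝ :=
  ∑ i, ∏ j, (if j = i then psiMajB hF hG n j (p j) else psiMaj hF hG j (p j))

variable (hF : ∀ j, IsSieveCutoff (F j) (sF j)) (hG : ∀ j, IsSieveCutoff (G j) (sG j))

omit [Fintype ι] [DecidableEq ι] in
/-- `ψ_j ≥ 0`. [folklore] -/
theorem psiMaj_nonneg (j : ι) (q : ℝ × ℝ) : 0 ≤ psiMaj hF hG j q := by
  unfold psiMaj; positivity

omit [DecidableEq ι] in
/-- `Ψ ≥ 0`. [folklore] -/
theorem PsiMaj_nonneg (p : ι → ℝ × ℝ) : 0 ≤ PsiMaj hF hG p :=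
  Finset.prod_nonneg fun j _ => psiMaj_nonneg hF hG j (p j)

/-- `Ψ_n = Ψ · ∑_i ((1+|ξ_i|)^n + (1+|ξ'_i|)^n)`. [folklore] -/
theorem PsiMajB_eq (n : ℕ) (p : ι → ℝ × ℝ) :
    PsiMajB hF hG n p = PsiMaj hF hG p * ∑ i, ((1 + |(p i).1|) ^ n + (1 + |(p i).2|) ^ n) := by
  unfold PsiMajB PsiMaj
  rw [Finset.mul_sum]
  refine Finset.sum_congr rfl fun i _ => ?_
  have h : ∀ j, (if j = i then psiMajB hF hG n j (p j) else psiMaj hF hG j (p j)) =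
      psiMaj hF hG j (p j) * (if j = i then ((1 + |(p j).1|) ^ n + (1 + |(p j).2|) ^ n) else 1) := by
    intro j
    split_ifs with hj
    · rfl
    · rw [mul_one]
  simp_rw [h]
  rw [Finset.prod_mul_distrib, Finset.prod_ite_eq']
  simp

/-- `Ψ_n ≥ 0`. [folklore] -/
theorem PsiMajB_nonneg (n : ℕ) (p : ι → ℝ × ℝ) : 0 ≤ PsiMajB hF hG n p := by
  rw [PsiMajB_eq]
  exact mul_nonneg (PsiMaj_nonneg hF hG p) (Finset.sum_nonneg fun i _ => by positivity)

omit [Fintype ι] [DecidableEq ι] in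
/-- `ψ_j` is integrable on `ℝ²`. [folklore] -/
theorem integrable_psiMaj (j : ι) : Integrable (psiMaj hF hG j) := by
  have h1 := integrable_weightMaj (hF j) 0
  have h2 := integrable_weightMaj (hG j) 0
  simp only [pow_zero, mul_one] at h1 h2
  exact h1.mul_prod h2

omit [Fintype ι] [DecidableEq ι] in
/-- The boosted `ψ_j` is integrable on `ℝ²`. [folklore] -/
theorem integrable_psiMajB (n : ℕ) (j : ι) : Integrable (psiMajB hF hG n j) := by
  have h1 := integrable_weightMaj (hF j) 0
  have h2 := integrable_weightMaj (hG j) 0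
  have h1n := integrable_weightMaj (hF j) n
  have h2n := integrable_weightMaj (hG j) n
  simp only [pow_zero, mul_one] at h1 h2
  refine ((h1n.mul_prod h2).add (h1.mul_prod h2n)).congr (Eventually.of_forall fun q => ?_)
  simp only [psiMajB, psiMaj, Pi.add_apply]
  ring

omit [DecidableEq ι] in
/-- `Ψ` is integrable. [folklore] -/
theorem integrable_PsiMaj : Integrable (PsiMaj hF hG) := by
  have h := Integrable.fintype_prod (f := fun j => psiMaj hF hG j) (integrable_psiMaj hF hG)
  exact h

/-- `Ψ_n` is integrable. [folklore] -/
theorem integrable_PsiMajB (n : ℕ) : Integrable (PsiMajB hF hG n) := by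
  unfold PsiMajB
  refine integrable_finsetSum _ fun i _ => ?_
  have hf : ∀ j, Integrable ((fun j => if j = i then psiMajB hF hG n j else psiMaj hF hG j) j)
      (volume : Measure (ℝ × ℝ)) := fun j => by
    by_cases hj : j = i
    · simp only [hj, if_true]; exact integrable_psiMajB hF hG n i
    · simp only [hj, if_false]; exact integrable_psiMaj hF hG j
  have h := Integrable.fintype_prod hf
  refine h.congr (Eventually.of_forall fun p => ?_)
  refine Finset.prod_congr rfl fun j _ => ?_
  split_ifs <;> rfl

/-! ### Pointwise bounds -/

omit [DecidableEq ι] in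
/-- `|Φ(p)| ≤ Ψ(p)`. [folklore] -/
theorem norm_fourierPhi_le (p : ι → ℝ × ℝ) : ‖fourierPhi hF hG p‖ ≤ PsiMaj hF hG p := by
  rw [fourierPhi, PsiMaj, norm_prod]
  refine Finset.prod_le_prod (fun j _ => norm_nonneg _) fun j _ => ?_
  rw [norm_mul, psiMaj]
  have hπ := Real.pi_pos
  have ha : ‖(hF j).fourierWeight (p j).1‖ ≤ (1 + 2 * π * |(p j).1|) * ‖(hF j).fourierWeight (p j).1‖ :=
    le_mul_of_one_le_left (norm_nonneg _) (by nlinarith [abs_nonneg (p j).1])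
  have hb : ‖(hG j).fourierWeight (p j).2‖ ≤ (1 + 2 * π * |(p j).2|) * ‖(hG j).fourierWeight (p j).2‖ :=
    le_mul_of_one_le_left (norm_nonneg _) (by nlinarith [abs_nonneg (p j).2])
  exact mul_le_mul ha hb (norm_nonneg _) (by positivity)

omit [DecidableEq ι] in
/-- `|Φ(p)| |M(p)| ≤ Ψ(p)`. [folklore] -/
theorem norm_fourierPhi_mul_pairModel_le (p : ι → ℝ × ℝ) :
    ‖fourierPhi hF hG p‖ * ‖pairModel p‖ ≤ PsiMaj hF hG p := by
  rw [fourierPhi, pairModel, PsiMaj, norm_prod, norm_prod, ← Finset.prod_mul_distrib]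
  refine Finset.prod_le_prod (fun j _ => by positivity) fun j _ => ?_
  rw [norm_mul, psiMaj]
  have hk := norm_lcmPairKernel_le (p j)
  have h0 : 0 ≤ ‖(hF j).fourierWeight (p j).1‖ := norm_nonneg _
  have h0' : 0 ≤ ‖(hG j).fourierWeight (p j).2‖ := norm_nonneg _
  have hP : 0 ≤ (1 + 2 * π * |(p j).1|) * (1 + 2 * π * |(p j).2|) := by positivity
  calc ‖(hF j).fourierWeight (p j).1‖ * ‖(hG j).fourierWeight (p j).2‖ * ‖lcmPairKernel (p j)‖
      ≤ ‖(hF j).fourierWeight (p j).1‖ * ‖(hG j).fourierWeight (p j).2‖ *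
          ((1 + 2 * π * |(p j).1|) * (1 + 2 * π * |(p j).2|)) := by
        refine mul_le_mul_of_nonneg_left (hk.trans ?_) (by positivity)
        linarith
    _ = _ := by ring

omit [DecidableEq ι] in
/-- `Φ · M` is integrable. [folklore] -/
theorem integrable_fourierPhi_mul_pairModel :
    Integrable fun p : ι → ℝ × ℝ => fourierPhi hF hG p * pairModel p := by
  refine (integrable_PsiMaj hF hG).mono' ?_ (Eventually.of_forall fun p => ?_)
  · have hc : Continuous (pairModel (ι := ι)) := by
      unfold pairModel
      exact continuous_finsetProd _ fun j _ => continuous_lcmPairKernel.comp (continuous_apply j)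
    exact ((continuous_fourierPhi hF hG).mul hc).aestronglyMeasurable
  · rw [norm_mul]; exact norm_fourierPhi_mul_pairModel_le hF hG p

omit [DecidableEq ι] in
/-- **`c = ∫ Φ M`**: `∫ Φ(p) M(p) dp = ∏_j ∫_0^∞ F_j' G_j'` (Fubini over `j` and the identity
`integral_Ioi_deriv_mul_deriv_eq`; Polymath 8b p. 13: "By Fubini's theorem, it suffices to show that
`∫∫ (1+iξ)(1+iξ')/(2+iξ+iξ') f_j(ξ)g_j(ξ') dξdξ' = ∫_0^∞ F_j'(t)G_j'(t) dt` for each `j`").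
[cite: Polymath8b2014, Lemma 4.1 (proof, p. 13)] -/
theorem integral_fourierPhi_mul_pairModel :
    ∫ p : ι → ℝ × ℝ, fourierPhi hF hG p * pairModel p =
      ∏ j, ((∫ t in Set.Ioi (0 : ℝ), deriv (F j) t * deriv (G j) t : ℝ) : ℂ) := by
  have h : ∀ p : ι → ℝ × ℝ, fourierPhi hF hG p * pairModel p =
      ∏ j, (lcmPairKernel (p j) * ((hF j).fourierWeight (p j).1 * (hG j).fourierWeight (p j).2)) := by
    intro p
    rw [fourierPhi, pairModel, ← Finset.prod_mul_distrib]
    exact Finset.prod_congr rfl fun j _ => by ring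
  simp_rw [h]
  rw [integral_fintype_prod_volume_eq_prod
    (f := fun j (q : ℝ × ℝ) => lcmPairKernel q * ((hF j).fourierWeight q.1 * (hG j).fourierWeight q.2))]
  exact Finset.prod_congr rfl fun j _ => (integral_Ioi_deriv_mul_deriv_eq (hF j) (hG j)).symm

omit [DecidableEq ι] in
/-- Off the cube of side `R ≥ 0`: `(1 + R)(R^{n-1} + 1) ≤ 2 ∑_i ((1+|ξ_i|)^n + (1+|ξ'_i|)^n)`, in the
two forms used. [folklore] -/
theorem offCube_bounds {R : ℝ} (hR : 0 ≤ R) {n : ℕ} (hn : 1 ≤ n) {p : ι → ℝ × ℝ}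
    (hp : ¬ InCube R p) :
    (1 + R) * R ^ (n - 1) ≤ ∑ i, ((1 + |(p i).1|) ^ n + (1 + |(p i).2|) ^ n) ∧
      (1 + R) ≤ ∑ i, ((1 + |(p i).1|) ^ n + (1 + |(p i).2|) ^ n) := by
  simp only [InCube, not_forall, not_and_or, not_le] at hp
  obtain ⟨i, hi⟩ := hp
  have hterm : ∀ i, 0 ≤ (1 + |(p i).1|) ^ n + (1 + |(p i).2|) ^ n := fun i => by positivity
  have hle : (1 + |(p i).1|) ^ n + (1 + |(p i).2|) ^ n ≤
      ∑ i, ((1 + |(p i).1|) ^ n + (1 + |(p i).2|) ^ n) :=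
    Finset.single_le_sum (f := fun i => (1 + |(p i).1|) ^ n + (1 + |(p i).2|) ^ n)
      (fun i _ => hterm i) (Finset.mem_univ i)
  -- the offending coordinate `a` with `R < |a|`
  have key : ∀ a : ℝ, R < |a| → (1 + R) * R ^ (n - 1) ≤ (1 + |a|) ^ n ∧ 1 + R ≤ (1 + |a|) ^ n := by
    intro a ha
    obtain ⟨m, rfl⟩ : ∃ m, n = m + 1 := ⟨n - 1, by omega⟩
    simp only [Nat.add_sub_cancel]
    have h1 : R ^ m ≤ (1 + |a|) ^ m := pow_le_pow_left₀ hR (by linarith) m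
    have h2 : (1 : ℝ) ≤ (1 + |a|) ^ m := one_le_pow₀ (by linarith [abs_nonneg a])
    have hRm : 0 ≤ R ^ m := by positivity
    constructor
    · rw [pow_succ]
      nlinarith
    · rw [pow_succ]
      nlinarith
  have h0 : 0 ≤ (1 + |(p i).1|) ^ n := by positivity
  have h0' : 0 ≤ (1 + |(p i).2|) ^ n := by positivity
  rcases hi with hi | hi
  · obtain ⟨k1, k2⟩ := key _ hi
    exact ⟨by linarith, by linarith⟩
  · obtain ⟨k1, k2⟩ := key _ hi
    exact ⟨by linarith, by linarith⟩

/-- **The pointwise bound**: for large `x` and every frequency `p`,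
`‖Φ(p)(B^k K_x(p) - M(p))‖ ≤ ε Ψ(p) + (C₀ + 1)/(1 + √log x) · Ψ_{8k+1}(p)` — on the cube by (kt)
(`eventually_norm_sub_pairModel_le`), off the cube by `K = O(log^{3k} x)`
(`eventually_norm_pow_mul_freqKernel_le`) and `log^{4k} x ≤ |ξ_i|^{8k}` for the offending coordinate
("the contribution … outside of the cube … is negligible", Polymath 8b p. 12).
[cite: Polymath8b2014, Lemma 4.1 (proof, pp. 12–13)] -/
theorem eventually_pointwise_bound {w : ℕ → ℂ} (hw : IsLcmWeight w) {ε : ℝ} (hε : 0 < ε) :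
    ∀ᶠ x : ℝ in atTop, ∀ p : ι → ℝ × ℝ,
      ‖fourierPhi hF hG p * ((polymathB x : ℂ) ^ Fintype.card ι * freqKernel w (polymathW x) x p -
          pairModel p)‖ ≤
        ε * PsiMaj hF hG p +
          (Real.exp (epsConst (Fintype.card ι)) * 4 ^ Fintype.card ι + 1) / (1 + Real.sqrt (Real.log x)) *
            PsiMajB hF hG (8 * Fintype.card ι + 1) p := by
  set k : ℕ := Fintype.card ι with hk
  set C₀ : ℝ := Real.exp (epsConst k) * 4 ^ k with hC₀
  have hC₀pos : 0 < C₀ := by positivity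
  filter_upwards [eventually_gt_atTop (1 : ℝ), eventually_norm_sub_pairModel_le (ι := ι) hw hε,
    eventually_norm_pow_mul_freqKernel_le (ι := ι) hw] with x hx hcube hglob
  intro p
  have hL : 0 < Real.log x := Real.log_pos hx
  set R : ℝ := Real.sqrt (Real.log x) with hRdef
  have hR0 : 0 ≤ R := Real.sqrt_nonneg _
  have hΨ := PsiMaj_nonneg hF hG p
  have hΨB := PsiMajB_nonneg hF hG (8 * k + 1) p
  have hΦΨ := norm_fourierPhi_le hF hG p
  have hΦMΨ := norm_fourierPhi_mul_pairModel_le hF hG p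
  have h2nonneg : 0 ≤ (C₀ + 1) / (1 + R) * PsiMajB hF hG (8 * k + 1) p := by positivity
  by_cases hc : InCube R p
  · -- on the cube
    have h1 := hcube p hc
    rw [norm_mul]
    calc ‖fourierPhi hF hG p‖ * ‖(polymathB x : ℂ) ^ k * freqKernel w (polymathW x) x p - pairModel p‖
        ≤ ‖fourierPhi hF hG p‖ * (ε * ‖pairModel p‖) := mul_le_mul_of_nonneg_left h1 (norm_nonneg _)
      _ = ε * (‖fourierPhi hF hG p‖ * ‖pairModel p‖) := by ring
      _ ≤ ε * PsiMaj hF hG p := mul_le_mul_of_nonneg_left hΦMΨ hε.le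
      _ ≤ _ := le_add_of_nonneg_right h2nonneg
  · -- off the cube
    have hglob' : ‖(polymathB x : ℂ) ^ k * freqKernel w (polymathW x) x p‖ ≤ C₀ * Real.log x ^ (4 * k) :=
      hglob p
    obtain ⟨hb1, hb2⟩ := offCube_bounds (ι := ι) hR0 (n := 8 * k + 1) (by omega) hc
    simp only [Nat.add_sub_cancel] at hb1
    set S : ℝ := ∑ i, ((1 + |(p i).1|) ^ (8 * k + 1) + (1 + |(p i).2|) ^ (8 * k + 1)) with hS
    have hRpow : R ^ (8 * k) = Real.log x ^ (4 * k) := by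
      rw [show 8 * k = 2 * (4 * k) by ring, pow_mul, hRdef, Real.sq_sqrt hL.le]
    have hR1 : 0 < 1 + R := by linarith
    rw [norm_mul, PsiMajB_eq, ← hS]
    have hstep : ‖(polymathB x : ℂ) ^ k * freqKernel w (polymathW x) x p - pairModel p‖ ≤
        C₀ * Real.log x ^ (4 * k) + ‖pairModel p‖ := (norm_sub_le _ _).trans (by linarith)
    calc ‖fourierPhi hF hG p‖ * ‖(polymathB x : ℂ) ^ k * freqKernel w (polymathW x) x p - pairModel p‖
        ≤ ‖fourierPhi hF hG p‖ * (C₀ * Real.log x ^ (4 * k) + ‖pairModel p‖) :=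
          mul_le_mul_of_nonneg_left hstep (norm_nonneg _)
      _ = C₀ * (‖fourierPhi hF hG p‖ * R ^ (8 * k)) + ‖fourierPhi hF hG p‖ * ‖pairModel p‖ := by
          rw [hRpow]; ring
      _ ≤ C₀ * (PsiMaj hF hG p * R ^ (8 * k)) + PsiMaj hF hG p := by
          gcongr
      _ ≤ C₀ * (PsiMaj hF hG p * (S / (1 + R))) + PsiMaj hF hG p * (S / (1 + R)) := by
          have hq : R ^ (8 * k) ≤ S / (1 + R) := by
            rw [le_div_iff₀ hR1]; linarith
          have hq' : 1 ≤ S / (1 + R) := by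
            rw [le_div_iff₀ hR1]; linarith
          have := mul_le_mul_of_nonneg_left hq hΨ
          have h' := mul_le_mul_of_nonneg_left hq' hΨ
          rw [mul_one] at h'
          gcongr
      _ = (C₀ + 1) / (1 + R) * (PsiMaj hF hG p * S) := by
          field_simp
      _ ≤ _ := le_add_of_nonneg_left (by positivity)

/-! ### The limit -/

/-- **Polymath 8b, Lemma 4.1 (general denominator weight), in the form `B^k · (multisum) → c`**:
for an admissible weight `w` (`1/[d_j,d'_j]` or `1/φ([d_j,d'_j])`) and smooth compactly supported
cutoffs, `B^k ∑_{d,d'} ∏_j μ(d_j)μ(d'_j)F_j(log_x d_j)G_j(log_x d'_j) w([d_j,d'_j]) → ∏_j ∫_0^∞ F_j' G_j'`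
as `x → ∞`. [cite: Polymath8b2014, Lemma 4.1] -/
theorem tendsto_pow_mul_lcmSumW (hF : ∀ j, IsSieveCutoff (F j) (sF j))
    (hG : ∀ j, IsSieveCutoff (G j) (sG j)) {w : ℕ → ℂ} (hw : IsLcmWeight w) {T : ℝ}
    (hTF : ∀ j, sF j ≤ T) (hTG : ∀ j, sG j ≤ T) :
    Tendsto (fun x : ℝ => (polymathB x : ℂ) ^ Fintype.card ι * lcmSumW w (polymathW x) F G x ⌊x ^ T⌋₊)
      atTop (𝓝 (∏ j, ((∫ t in Set.Ioi (0 : ℝ), deriv (F j) t * deriv (G j) t : ℝ) : ℂ))) := by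
  set k : ℕ := Fintype.card ι with hk
  set c : ℂ := ∏ j, ((∫ t in Set.Ioi (0 : ℝ), deriv (F j) t * deriv (G j) t : ℝ) : ℂ) with hc
  set C₀ : ℝ := Real.exp (epsConst k) * 4 ^ k with hC₀
  set IΨ : ℝ := ∫ p, PsiMaj hF hG p with hIΨ
  set IΨB : ℝ := ∫ p, PsiMajB hF hG (8 * k + 1) p with hIΨB
  have hIΨ0 : 0 ≤ IΨ := integral_nonneg (PsiMaj_nonneg hF hG)
  have hIΨB0 : 0 ≤ IΨB := integral_nonneg (PsiMajB_nonneg hF hG _)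
  rw [Metric.tendsto_nhds]
  intro η hη
  set ε : ℝ := η / (2 * (IΨ + 1)) with hεdef
  have hε : 0 < ε := by positivity
  have hεI : ε * IΨ < η / 2 := by
    rw [hεdef, div_mul_eq_mul_div, div_lt_div_iff₀ (by positivity) (by positivity)]
    nlinarith
  -- the coefficient of the second term tends to `0`
  have htail : Tendsto (fun x : ℝ => (C₀ + 1) / (1 + Real.sqrt (Real.log x)) * IΨB) atTop (𝓝 0) := by
    have h1 : Tendsto (fun x : ℝ => 1 + Real.sqrt (Real.log x)) atTop atTop :=
      tendsto_atTop_add_const_left _ 1 (Real.tendsto_sqrt_atTop.comp Real.tendsto_log_atTop)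
    have h2 := (tendsto_const_nhds (x := C₀ + 1)).div_atTop h1
    simpa using h2.mul_const IΨB
  filter_upwards [eventually_gt_atTop (1 : ℝ), eventually_pointwise_bound hF hG hw hε,
    htail.eventually_lt_const (half_pos hη)] with x hx hpt htl
  have hrep := lcmSumW_eq_integral_freqKernel hF hG hw (polymathW x) hx hTF hTG
  -- `B^k S - c = ∫ Φ (B^k K - M)`
  have hint1 := (integrable_fourierPhi_mul_freqKernel hF hG hw (polymathW x) hx).const_mul
    ((polymathB x : ℂ) ^ k)
  have hint2 := integrable_fourierPhi_mul_pairModel hF hG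
  have hdiff : (polymathB x : ℂ) ^ k * lcmSumW w (polymathW x) F G x ⌊x ^ T⌋₊ - c =
      ∫ p : ι → ℝ × ℝ, fourierPhi hF hG p *
        ((polymathB x : ℂ) ^ k * freqKernel w (polymathW x) x p - pairModel p) := by
    rw [hrep, ← integral_const_mul, hc, ← integral_fourierPhi_mul_pairModel hF hG,
      ← integral_sub hint1 hint2]
    exact integral_congr_ae (Eventually.of_forall fun p => by ring)
  rw [dist_eq_norm, hdiff]
  have hi1 := (integrable_PsiMaj hF hG).const_mul ε
  have hi2 := (integrable_PsiMajB hF hG (8 * k + 1)).const_mul ((C₀ + 1) / (1 + Real.sqrt (Real.log x)))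
  have hbound := norm_integral_le_of_norm_le (hi1.add hi2) (Eventually.of_forall (hpt))
  refine lt_of_le_of_lt hbound ?_
  have hsum : ∫ p : ι → ℝ × ℝ, (ε * PsiMaj hF hG p +
      (C₀ + 1) / (1 + Real.sqrt (Real.log x)) * PsiMajB hF hG (8 * k + 1) p) =
      ε * IΨ + (C₀ + 1) / (1 + Real.sqrt (Real.log x)) * IΨB := by
    rw [integral_add hi1 hi2, integral_const_mul, integral_const_mul]
  refine lt_of_eq_of_lt ?_ (show ε * IΨ + (C₀ + 1) / (1 + Real.sqrt (Real.log x)) * IΨB < η by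
    have htl' : (C₀ + 1) / (1 + Real.sqrt (Real.log x)) * IΨB < η / 2 := htl
    linarith)
  rw [← hsum]
  rfl

end Assembly


end LcmEuler

/-! ## Lemma 4.1 and Theorem 3.6(i) discharged -/

open LcmEuler in
/-- **Polymath 8b, Lemma 4.1 (case `N = 1`), PROVED**: the named fact `moebiusLcmSums_asymptotic` of
`PolymathLcmSums.lean` —
`∑_{[d_j,d'_j], W coprime} ∏_j μ(d_j)μ(d'_j)F_j(log_x d_j)G_j(log_x d'_j)/[d_j,d'_j] = (c + o(1)) B^{-k}`,
`c = ∏_j ∫_0^∞ F_j' G_j'` — DISCHARGED along the printed proof (pp. 12–13): Fourier expansion (etf)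
and Fubini (`lcmSumW_eq_integral_freqKernel`), Euler product and (kp-est) (`K = E·Z`,
`PolymathLcmSumsEuler/Zeta.lean`), the simple pole of `ζ` on the cube `|ξ| ≤ √log x`
(`eventually_norm_sub_pairModel_le`), the crude bound `K = O(log^{3k} x)` with the rapid decay of
`f_j, g_j` off the cube (`eventually_pointwise_bound`), and `∫∫ (1+iξ)(1+iξ')/(2+iξ+iξ') f g = ∫ F'G'`
(`integral_fourierPhi_mul_pairModel`); the weight `1/n` is admissible (`isLcmWeight_inv`).
[cite: Polymath8b2014, Lemma 4.1] -/
theorem moebiusLcmSums_asymptotic_holds : moebiusLcmSums_asymptotic := by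
  intro ι _ _ _ F G sF sG hF hG T hTF hTG
  set c : ℝ := ∏ j, ∫ t in Set.Ioi (0 : ℝ), deriv (F j) t * deriv (G j) t with hc
  -- the complex limit `B^k · lcmSumW → c`
  have h := tendsto_pow_mul_lcmSumW hF hG isLcmWeight_inv hTF hTG
  -- its real form
  have hreal : Tendsto (fun x : ℝ => polymathB x ^ Fintype.card ι * lcmSum (polymathW x) F G x ⌊x ^ T⌋₊)
      atTop (𝓝 c) := by
    have h2 := (Complex.continuous_re.tendsto _).comp h
    rw [← Complex.ofReal_prod, Complex.ofReal_re] at h2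
    refine h2.congr fun x => ?_
    rw [Function.comp_apply, ← ofReal_lcmSum, ← Complex.ofReal_pow, ← Complex.ofReal_mul,
      Complex.ofReal_re]
  -- `B^k S - c → 0`, i.e. `S - c B^{-k} = o(B^{-k})`
  have hg : Tendsto (fun x : ℝ => polymathB x ^ Fintype.card ι * lcmSum (polymathW x) F G x ⌊x ^ T⌋₊ - c)
      atTop (𝓝 0) := by
    rw [← sub_self c]
    exact hreal.sub_const c
  have ho := (Asymptotics.isLittleO_one_iff ℝ).2 hg
  have hO : (fun x : ℝ => (polymathB x ^ Fintype.card ι)⁻¹) =O[atTop]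
      fun x : ℝ => (polymathB x ^ Fintype.card ι)⁻¹ := Asymptotics.isBigO_refl _ _
  have h3 := hO.mul_isLittleO ho
  refine h3.congr' ?_ (Eventually.of_forall fun x => mul_one _)
  filter_upwards [eventually_gt_atTop (1 : ℝ)] with x hx
  have hB : polymathB x ^ Fintype.card ι ≠ 0 := (pow_pos (polymathB_pos hx) _).ne'
  rw [hc]
  field_simp

/-- **Polymath 8b, Theorem 3.6(i), PROVED** (the named fact `divisorSumWeights_asymptotic` of
`PolymathSieveAsymptotics.lean`): the asymptotic for the non-prime sums
`∑_{x ≤ n ≤ 2x, n = b (W)} ∏ᵢ λ_{Fᵢ}(n+hᵢ)λ_{Gᵢ}(n+hᵢ) = (c + o(1)) B^{-k} x/W`, by §4.1 ("The trivial case",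
`divisorSumWeights_asymptotic_of_lcmSums`) from Lemma 4.1 (`moebiusLcmSums_asymptotic_holds`).
[cite: Polymath8b2014, Theorem 3.6(i)] -/
theorem divisorSumWeights_asymptotic_holds : divisorSumWeights_asymptotic :=
  divisorSumWeights_asymptotic_of_lcmSums moebiusLcmSums_asymptotic_holds

end Literature.NumberTheory.Sieve
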